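import Summits.ValiantsHypothesis.ValiantsHypothesis.Theorems.BarrierLeverAnchoredDoorHitsLowerPairsSimplexBoundary
import Mathlib.Data.Finset.Interval

/-!
# Support item `AnchoredDoorHitsLowerPairs` (stmt-ValiantsHypothesis-22510), line `anchored-peeling`:
# the family (∂Δⁿ, Δⁿ⁻¹ ⊔ Δⁿ⁻¹) is RIGID — no star(`s`) step for `n > s` (part 3)

Helper file (`--supports stmt-ValiantsHypothesis-22510`; cell valiant-natproofs, rung V4, 𝒟-side door (c); prover seat
val-np-p1 gen 16). Closes NO item. Definition-free.

Parts 1–2 (`…SimplexBoundaryMember`, `…SimplexBoundary`) prove that every anchored door 𝔄_s has nonzero symbolic minor on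
`P_n` = (rows: all subsets of `{x_0,…,x_{n-1}, x_{2n}}` but the full one; columns: all subsets of `{y_0,…,y_{n-1}}` and of
`{y_n,…,y_{2n-1}}`). This part certifies, in the exact terms of the registered open stub `Stmt.stub_rigidPairs` of the line
`Cruxes/AnchoredDoorHitsLowerPairs/Lines/anchored_peeling.lean`, that `P_n` admits NO star(`s`) step when `s < n`
(`simplexBoundary_noStarStep`): for faces `Z` of the rows and `W` of the columns with `1 ≤ |Z|`, `1 ≤ |W|` and
`|Z| ≤ s ∨ |W| ≤ s`, the star counts `#{i : Z ⊆ u i}` and `#{j : W ⊆ w j}` differ. Indeed (`rowStar_lo`, `rowStar_apex`,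
`colStar_lo`, `colStar_hi`) the row stars are `2^{n+1-|Z|} - 1` (odd) and the column stars `2^{n-|W|}` (even unless `W` is a
facet), so equality forces `|Z| = |W| = n > s`. Hence `{P_n}_{n > s}` is an infinite family INSIDE the hypothesis class of
`stub_rigidPairs` for every profile `s`, on which the stub's conclusion is a kernel theorem (part 2) — the peeling induction of
the line cannot reach `P_n`, the one-twist certificate does.

WHAT THIS IS NOT: nothing on `stub_rigidPairs` for other pairs, on item 19717, on crux stmt-ValiantsHypothesis-14610, or on
`VP` versus `VNP`.
-/

set_option linter.dupNamespace false

namespace Summit.ValiantsHypothesis.ValiantsHypothesis.Theorems.BarrierLever.AnchoredPeeling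

open Finset

noncomputable section

namespace SimplexBoundary

variable {n : ℕ}

/-! ## 1. Counting supersets -/

/-- Counting through an injective enumeration. -/
theorem card_filter_comp_of_injective {ι α : Type*} [Fintype ι] [DecidableEq α] (f : ι → α)
    (hf : Function.Injective f) (p : α → Prop) [DecidablePred p] :
    (univ.filter (fun i => p (f i))).card = ((univ.image f).filter p).card := by
  rw [Finset.filter_image, Finset.card_image_of_injective _ hf]

/-- Supersets of `Z'` in `2^{[n]}`: `2^{n - |Z'|}`. -/
theorem card_filter_superset (Z' : Finset (Fin n)) :
    (univ.filter (fun U : Finset (Fin n) => Z' ⊆ U)).card = 2 ^ (n - Z'.card) := by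
  have hI : univ.filter (fun U : Finset (Fin n) => Z' ⊆ U) = Finset.Icc Z' univ := by
    ext U; simp [Finset.mem_Icc]
  rw [hI, Finset.card_Icc_finset (Finset.subset_univ _), Finset.card_univ, Fintype.card_fin]

/-- Proper supersets-or-equal of `Z'` other than the top: `2^{n - |Z'|} - 1`. -/
theorem card_filter_superset_ne_univ (Z' : Finset (Fin n)) :
    (univ.filter (fun U : Finset (Fin n) => Z' ⊆ U ∧ U ≠ univ)).card = 2 ^ (n - Z'.card) - 1 := by
  have hI : univ.filter (fun U : Finset (Fin n) => Z' ⊆ U ∧ U ≠ univ) = Finset.Ico Z' univ := by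
    ext U
    simp only [Finset.mem_filter, Finset.mem_univ, true_and, Finset.mem_Ico, lt_iff_le_and_ne, Finset.subset_univ, ne_eq]
  rw [hI, Finset.card_Ico_finset (Finset.subset_univ _), Finset.card_univ, Fintype.card_fin]

/-! ## 2. Star counts of `P_n` -/

section Stars

variable {r : ℕ} (u w : Fin r → Finset (Fin (2 * n + 1)))

/-- Column stars, block 1: `#{j : lo(W') ⊆ w j} = 2^{n - |W'|}` for nonempty `W'`. -/
theorem colStar_lo (hw : Function.Injective w)
    (hC : Set.range w = {T | ∃ U : Finset (Fin n), T = U.map (lo n) ∨ T = U.map (hi n)})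
    (W' : Finset (Fin n)) (hW' : W'.Nonempty) :
    (univ.filter (fun j => W'.map (lo n) ⊆ w j)).card = 2 ^ (n - W'.card) := by
  classical
  rw [card_filter_comp_of_injective w hw (fun T => W'.map (lo n) ⊆ T)]
  have hset : (univ.image w).filter (fun T => W'.map (lo n) ⊆ T) =
      (univ.filter (fun U : Finset (Fin n) => W' ⊆ U)).image (fun U => U.map (lo n)) := by
    ext T
    simp only [Finset.mem_filter, Finset.mem_image, Finset.mem_univ, true_and]
    constructor
    · rintro ⟨⟨j, rfl⟩, hsub⟩
      have hT : w j ∈ Set.range w := ⟨j, rfl⟩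
      rw [hC] at hT
      obtain ⟨U, hU | hU⟩ := hT
      · exact ⟨U, Finset.map_subset_map.mp (hU ▸ hsub), hU.symm⟩
      · exfalso
        obtain ⟨c, hc⟩ := hW'
        exact lo_not_mem_map_hi U c ((hU ▸ hsub) (Finset.mem_map_of_mem _ hc))
    · rintro ⟨U, hWU, rfl⟩
      refine ⟨?_, Finset.map_subset_map.mpr hWU⟩
      have hmem : U.map (lo n) ∈ Set.range w := by rw [hC]; exact ⟨U, Or.inl rfl⟩
      obtain ⟨j, hj⟩ := hmem
      exact ⟨j, hj⟩
  rw [hset, Finset.card_image_of_injective _ (Finset.map_injective (lo n)), card_filter_superset]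

/-- Column stars, block 2: `#{j : hi(W') ⊆ w j} = 2^{n - |W'|}` for nonempty `W'`. -/
theorem colStar_hi (hw : Function.Injective w)
    (hC : Set.range w = {T | ∃ U : Finset (Fin n), T = U.map (lo n) ∨ T = U.map (hi n)})
    (W' : Finset (Fin n)) (hW' : W'.Nonempty) :
    (univ.filter (fun j => W'.map (hi n) ⊆ w j)).card = 2 ^ (n - W'.card) := by
  classical
  rw [card_filter_comp_of_injective w hw (fun T => W'.map (hi n) ⊆ T)]
  have hset : (univ.image w).filter (fun T => W'.map (hi n) ⊆ T) =
      (univ.filter (fun U : Finset (Fin n) => W' ⊆ U)).image (fun U => U.map (hi n)) := by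
    ext T
    simp only [Finset.mem_filter, Finset.mem_image, Finset.mem_univ, true_and]
    constructor
    · rintro ⟨⟨j, rfl⟩, hsub⟩
      have hT : w j ∈ Set.range w := ⟨j, rfl⟩
      rw [hC] at hT
      obtain ⟨U, hU | hU⟩ := hT
      · exfalso
        obtain ⟨c, hc⟩ := hW'
        exact hi_not_mem_map_lo U c ((hU ▸ hsub) (Finset.mem_map_of_mem _ hc))
      · exact ⟨U, Finset.map_subset_map.mp (hU ▸ hsub), hU.symm⟩
    · rintro ⟨U, hWU, rfl⟩
      refine ⟨?_, Finset.map_subset_map.mpr hWU⟩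
      have hmem : U.map (hi n) ∈ Set.range w := by rw [hC]; exact ⟨U, Or.inr rfl⟩
      obtain ⟨j, hj⟩ := hmem
      exact ⟨j, hj⟩
  rw [hset, Finset.card_image_of_injective _ (Finset.map_injective (hi n)), card_filter_superset]

/-- Row stars of an apex-free face: `#{i : lo(Z') ⊆ u i} = 2^{n-|Z'|} + (2^{n-|Z'|} - 1)`. -/
theorem rowStar_lo (hu : Function.Injective u)
    (hR : Set.range u = {S | ∃ U : Finset (Fin n), S = U.map (lo n) ∨ (U ≠ univ ∧ S = insert (apex n) (U.map (lo n)))})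
    (Z' : Finset (Fin n)) :
    (univ.filter (fun i => Z'.map (lo n) ⊆ u i)).card = 2 ^ (n - Z'.card) + (2 ^ (n - Z'.card) - 1) := by
  classical
  rw [card_filter_comp_of_injective u hu (fun S => Z'.map (lo n) ⊆ S)]
  have hset : (univ.image u).filter (fun S => Z'.map (lo n) ⊆ S) =
      (univ.filter (fun U : Finset (Fin n) => Z' ⊆ U)).image (fun U => U.map (lo n)) ∪
      (univ.filter (fun U : Finset (Fin n) => Z' ⊆ U ∧ U ≠ univ)).image (fun U => insert (apex n) (U.map (lo n))) := by
    ext S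
    simp only [Finset.mem_filter, Finset.mem_image, Finset.mem_univ, true_and, Finset.mem_union]
    constructor
    · rintro ⟨⟨i, rfl⟩, hsub⟩
      have hS : u i ∈ Set.range u := ⟨i, rfl⟩
      rw [hR] at hS
      obtain ⟨U, hU | ⟨hUne, hU⟩⟩ := hS
      · exact Or.inl ⟨U, Finset.map_subset_map.mp (hU ▸ hsub), hU.symm⟩
      · refine Or.inr ⟨U, ⟨?_, hUne⟩, hU.symm⟩
        have h' : Z'.map (lo n) ⊆ insert (apex n) (U.map (lo n)) := hU ▸ hsub
        exact Finset.map_subset_map.mp ((Finset.subset_insert_iff_of_notMem (apex_not_mem_map_lo Z')).mp h')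
    · rintro (⟨U, hZU, rfl⟩ | ⟨U, ⟨hZU, hUne⟩, rfl⟩)
      · refine ⟨?_, Finset.map_subset_map.mpr hZU⟩
        have hmem : U.map (lo n) ∈ Set.range u := by rw [hR]; exact ⟨U, Or.inl rfl⟩
        obtain ⟨i, hi⟩ := hmem
        exact ⟨i, hi⟩
      · refine ⟨?_, (Finset.map_subset_map.mpr hZU).trans (Finset.subset_insert _ _)⟩
        have hmem : insert (apex n) (U.map (lo n)) ∈ Set.range u := by rw [hR]; exact ⟨U, Or.inr ⟨hUne, rfl⟩⟩
        obtain ⟨i, hi⟩ := hmem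
        exact ⟨i, hi⟩
  rw [hset, Finset.card_union_of_disjoint, Finset.card_image_of_injective _ (Finset.map_injective (lo n)),
    Finset.card_image_of_injective _ (fun U V hUV => insert_apex_inj hUV), card_filter_superset,
    card_filter_superset_ne_univ]
  rw [Finset.disjoint_left]
  intro S hS hS'
  obtain ⟨U, -, rfl⟩ := Finset.mem_image.mp hS
  obtain ⟨V, -, hV⟩ := Finset.mem_image.mp hS'
  exact apex_not_mem_map_lo U (hV ▸ Finset.mem_insert_self _ _)

/-- Row stars of an apex face: `#{i : apex ∪ lo(Z') ⊆ u i} = 2^{n-|Z'|} - 1`. -/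
theorem rowStar_apex (hu : Function.Injective u)
    (hR : Set.range u = {S | ∃ U : Finset (Fin n), S = U.map (lo n) ∨ (U ≠ univ ∧ S = insert (apex n) (U.map (lo n)))})
    (Z' : Finset (Fin n)) :
    (univ.filter (fun i => insert (apex n) (Z'.map (lo n)) ⊆ u i)).card = 2 ^ (n - Z'.card) - 1 := by
  classical
  rw [card_filter_comp_of_injective u hu (fun S => insert (apex n) (Z'.map (lo n)) ⊆ S)]
  have hset : (univ.image u).filter (fun S => insert (apex n) (Z'.map (lo n)) ⊆ S) =
      (univ.filter (fun U : Finset (Fin n) => Z' ⊆ U ∧ U ≠ univ)).image (fun U => insert (apex n) (U.map (lo n))) := by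
    ext S
    simp only [Finset.mem_filter, Finset.mem_image, Finset.mem_univ, true_and]
    constructor
    · rintro ⟨⟨i, rfl⟩, hsub⟩
      have hS : u i ∈ Set.range u := ⟨i, rfl⟩
      rw [hR] at hS
      obtain ⟨U, hU | ⟨hUne, hU⟩⟩ := hS
      · exfalso
        exact apex_not_mem_map_lo U ((hU ▸ hsub) (Finset.mem_insert_self _ _))
      · refine ⟨U, ⟨?_, hUne⟩, hU.symm⟩
        have h' : insert (apex n) (Z'.map (lo n)) ⊆ insert (apex n) (U.map (lo n)) := hU ▸ hsub
        have h'' := (Finset.insert_subset_iff.mp h').2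
        exact Finset.map_subset_map.mp ((Finset.subset_insert_iff_of_notMem (apex_not_mem_map_lo Z')).mp h'')
    · rintro ⟨U, ⟨hZU, hUne⟩, rfl⟩
      refine ⟨?_, Finset.insert_subset_insert _ (Finset.map_subset_map.mpr hZU)⟩
      have hmem : insert (apex n) (U.map (lo n)) ∈ Set.range u := by rw [hR]; exact ⟨U, Or.inr ⟨hUne, rfl⟩⟩
      obtain ⟨i, hi⟩ := hmem
      exact ⟨i, hi⟩
  rw [hset, Finset.card_image_of_injective _ (fun U V hUV => insert_apex_inj hUV), card_filter_superset_ne_univ]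

end Stars

/-! ## 3. No star step -/

/-- Powers of two: `2^a + (2^a - 1) = 2^j` forces `a = 0` and `j = 0`. -/
theorem two_pow_add_eq (a j : ℕ) (h : 2 ^ a + (2 ^ a - 1) = 2 ^ j) : a = 0 ∧ j = 0 := by
  have ha : 1 ≤ 2 ^ a := Nat.one_le_two_pow
  rcases Nat.eq_zero_or_pos j with hj | hj
  · subst hj
    rw [pow_zero] at h
    refine ⟨?_, rfl⟩
    by_contra hne
    have : 2 ≤ 2 ^ a := by
      calc 2 = 2 ^ 1 := by norm_num
        _ ≤ 2 ^ a := Nat.pow_le_pow_right (by norm_num) (Nat.one_le_iff_ne_zero.mpr hne)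
    omega
  · exfalso
    have h2 : 2 ∣ 2 ^ j := dvd_pow_self 2 (Nat.pos_iff_ne_zero.mp hj)
    omega

/-- Powers of two: `2^a - 1 = 2^j` with `1 ≤ a` forces `a = 1` and `j = 0`. -/
theorem two_pow_sub_one_eq (a j : ℕ) (ha : 1 ≤ a) (h : 2 ^ a - 1 = 2 ^ j) : a = 1 ∧ j = 0 := by
  have ha2 : 2 ≤ 2 ^ a := by
    calc 2 = 2 ^ 1 := by norm_num
      _ ≤ 2 ^ a := Nat.pow_le_pow_right (by norm_num) ha
  rcases Nat.eq_zero_or_pos j with hj | hj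
  · subst hj
    rw [pow_zero] at h
    refine ⟨?_, rfl⟩
    by_contra hne
    have : 4 ≤ 2 ^ a := by
      calc 4 = 2 ^ 2 := by norm_num
        _ ≤ 2 ^ a := Nat.pow_le_pow_right (by norm_num) (by omega)
    omega
  · exfalso
    have h2 : 2 ∣ 2 ^ j := dvd_pow_self 2 (Nat.pos_iff_ne_zero.mp hj)
    have h3 : 2 ∣ 2 ^ a := dvd_pow_self 2 (by omega)
    omega

/-- **`P_n` has no star(`s`) step for `s < n`** (the hypothesis of `Stmt.stub_rigidPairs`, verbatim shape). -/
theorem simplexBoundary_noStarStep (n s : ℕ) (hsn : s < n) {r : ℕ} (u w : Fin r → Finset (Fin (2 * n + 1)))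
    (hu : Function.Injective u) (hw : Function.Injective w)
    (hR : Set.range u = {S | ∃ U : Finset (Fin n), S = U.map (lo n) ∨ (U ≠ univ ∧ S = insert (apex n) (U.map (lo n)))})
    (hC : Set.range w = {T | ∃ U : Finset (Fin n), T = U.map (lo n) ∨ T = U.map (hi n)})
    (Z W : Finset (Fin (2 * n + 1))) (hZ : Z ∈ Set.range u) (hW : W ∈ Set.range w) (_hZ1 : 1 ≤ Z.card)
    (hW1 : 1 ≤ W.card) (hsmall : Z.card ≤ s ∨ W.card ≤ s) :
    (univ.filter (fun i => Z ⊆ u i)).card ≠ (univ.filter (fun j => W ⊆ w j)).card := by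
  classical
  -- the column star is a power of two, exponent `n - |W|`
  have hW' : ∃ W' : Finset (Fin n), W'.card = W.card ∧ (univ.filter (fun j => W ⊆ w j)).card = 2 ^ (n - W'.card) := by
    have hW0 := hW
    rw [hC] at hW0
    obtain ⟨W', hWl | hWh⟩ := hW0
    · have hne : W'.Nonempty := by
        rw [← Finset.card_pos, ← Finset.card_map (lo n), ← hWl]; exact hW1
      exact ⟨W', by rw [hWl, Finset.card_map], by rw [hWl]; exact colStar_lo w hw hC W' hne⟩
    · have hne : W'.Nonempty := by
        rw [← Finset.card_pos, ← Finset.card_map (hi n), ← hWh]; exact hW1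
      exact ⟨W', by rw [hWh, Finset.card_map], by rw [hWh]; exact colStar_hi w hw hC W' hne⟩
  obtain ⟨W', hWcard, hcol⟩ := hW'
  have hWle : W'.card ≤ n := by simpa using Finset.card_le_univ W'
  rw [hcol]
  have hZ0 := hZ
  rw [hR] at hZ0
  obtain ⟨Z', hZl | ⟨hZne, hZa⟩⟩ := hZ0
  · -- apex-free face
    rw [hZl, rowStar_lo u hu hR Z']
    intro heq
    obtain ⟨ha, hj⟩ := two_pow_add_eq _ _ heq
    have hZle : Z'.card ≤ n := by simpa using Finset.card_le_univ Z'
    have hZc : Z.card = Z'.card := by rw [hZl, Finset.card_map]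
    omega
  · -- apex face
    rw [hZa, rowStar_apex u hu hR Z']
    intro heq
    have hZlt : Z'.card < n := by
      have := Finset.card_lt_card (Finset.ssubset_univ_iff.mpr hZne)
      simpa using this
    obtain ⟨ha, hj⟩ := two_pow_sub_one_eq _ _ (by omega) heq
    have hZc : Z.card = Z'.card + 1 := by rw [hZa, Finset.card_insert_of_notMem (apex_not_mem_map_lo Z'), Finset.card_map]
    omega

end SimplexBoundary

end

end Summit.ValiantsHypothesis.ValiantsHypothesis.Theorems.BarrierLever.AnchoredPeeling
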